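import Summits.BirchSwinnertonDyer.Rank1Residual.GaloisImage.LocalUnitsValuationCount
import Summits.BirchSwinnertonDyer.Rank1Residual.GaloisImage.LocalUnitsModPUnits
import Summits.BirchSwinnertonDyer.Rank1Residual.GaloisImage.LocalIntegersNormalBasisCount
import HarnessLib

/-!
# Milne, *ADT* I Lemma 2.11 counted: `#Hom_Δ(Z, Eˣ/p) = #(𝒪_K/p)^r · #Hom_Δ(Z, Eˣ[p]) · #Z^Δ`
# (cell `b2b-bsdres`, team n1011, row T-EPC = Tate's local Euler–Poincaré characteristic; seat p04 GEN 8; stage B7)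

HONEST FRAMING (cell `b2b-bsdres`, run/shared/lean/b2b/bsd-rank1-residual/, verbatim in every
file): the goal of the cell is to DELETE the COMBINATION-SHAPED residual classes of the
Birch–Swinnerton-Dyer formula for ALL analytic-rank `≤ 1` elliptic curves over `ℚ` — "full BSD
formula for every rank `≤ 1` curve in class `C`" assembled STRICTLY from published theorems — so
that the rank-`≤ 1` remainder becomes exactly the CONSTRUCTION-SHAPED classes, which are TYPED
(missing-input `Prop`s), NOT attempted. This is not "finishing BSD". Team n1011 (N10 / N11, the
additive block X4 ∧ `p = 3`): research route; no claim beyond the stated classes; nothing is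
booked; no mark / label is changed by this file. Theorems only (no definition, no named fact, no
`sorry`); TOOL theorems on local fields.  (Placement: Summits/GaloisImage, as stages A1–B6b.)

## What

Milne, *Arithmetic Duality Theorems*, I §2, LEMMA 2.11 (p. 33): for a finite Galois extension
`L/K` of `p`-adic fields with group `G`, "`[L^{×(p)}] = [𝔽_p] + [R^{(p)}] … + [μ_p(L)]`-type identity
in `R_{𝔽_p}(G)`", i.e. `[L^×/L^{×p}] = [K:ℚ_p]·[𝔽_p[G]] + [μ_p(L)] + [𝔽_p]` — proved there with the
exponential; here assembled log-free from stages B4c (`𝒪_Eˣ ⊇ U♭ ⊇ U_1`, Lemma 2.12 with torsion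
and Bezout), B5b (the valuation sequence), B6b (the normal-basis count) and B5a (`𝒪_Eˣ[p] = Eˣ[p]`),
in the counting currency of stage A1 (`p ∤ #G`, so a class in `R_{𝔽_p}(G)` is the function
`Z ↦ #Hom_G(Z, ·)`):

* `OneUnits.natCard_modP_field_units_eq` — for `E/K` finite Galois with `Δ = Gal(E/K)` of order
  prime to `p` preserving the valuation of the characteristic-`0` local field `E` (`|p| < 1`),
  `𝒪_K = K ∩ 𝒪_E` and `Z` finite with `pZ = 0`, `#Z = p^r`:
  **`#Hom_Δ(Z, Eˣ/Eˣᵖ) = #(𝒪_K/p𝒪_K)^r · #Hom_Δ(Z, Eˣ[p]) · #Z^Δ`**;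
* `OneUnits.natCard_modP_field_units_eq'` — the same with the bookkeeping subgroups
  `U_1, U_2, U_3, 𝒪_Eˣ, 𝒪_E` supplied by the caller (for consumers already holding them).

This closes stage B of the T-EPC programme (`hEP` discharge): with stage C (`H¹(Γ_E, W) = Hom`,
Kummer `Hom_cont(Γ_E, μ_p) ≅ Eˣ/p`, (2,0)-duality) it yields `h¹ = h⁰ h² #(𝒪_K/#W)` over the tame
layer.

References: J. S. Milne, *Arithmetic Duality Theorems*, 2nd ed. (2006), I §2, Lemma 2.11 and the
proof of Thm. 2.8 (pp. 33–34) [MilneADT2006]; J.-P. Serre, *Local Fields*, XIV §4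
[SerreLocalFields1979].
-/

noncomputable section

open Function
open scoped ValuativeRel

namespace Summit.BirchSwinnertonDyer.Rank1Residual.GaloisImage

namespace OneUnits

open Representation

variable {K : Type*} [Field K] {E : Type*} [Field E] [Algebra K E] [ValuativeRel E]
  [TopologicalSpace E] [IsNonarchimedeanLocalField E]
variable (p : ℕ) [hp : Fact p.Prime] [FiniteDimensional K E] [IsGalois K E]

/-- **Milne I Lemma 2.11, counted, with the bookkeeping subgroups supplied**: for `E/K` finite
Galois, `Δ = Gal(E/K)` of order prime to `p` preserving the valuation of the characteristic-`0`
local field `E` (`|p| < 1`), `Z` a finite `Δ`-module with `pZ = 0` and `#Z = p^r`, and the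
membership-characterised subgroups `U_1 ⊇ U_2 ⊇ U_3` (one-units), `𝒪_Eˣ`, `𝒪_E`, `𝒪_K`:
`#Hom_Δ(Z, Eˣ/p) = #(𝒪_K/p)^r · #Hom_Δ(Z, Eˣ[p]) · #Z^Δ`.
[cite: MilneADT2006, I §2 Lemma 2.11 (p. 33) and proof of Thm 2.8 (p. 34)] -/
theorem natCard_modP_field_units_eq' [CharZero E] (hpv : ValuativeRel.valuation E p < 1)
    (hσ : ∀ (σ : E ≃ₐ[K] E) (x : E), ValuativeRel.valuation E (σ x) = ValuativeRel.valuation E x)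
    (hG : ¬ p ∣ Nat.card (E ≃ₐ[K] E))
    {Z : Type*} [AddCommGroup Z] [Finite Z] (σZ : Representation ℤ (E ≃ₐ[K] E) Z)
    (hZ : ∀ z : Z, p • z = 0) {r : ℕ} (hcard : Nat.card Z = p ^ r)
    (U₁ U₂ U₃ OU : Submodule ℤ (Additive Eˣ))
    (hU₁ : ∀ u : Additive Eˣ, u ∈ U₁ ↔ ∃ b ∈ 𝒪[E], ((Additive.toMul u : Eˣ) : E) = 1 + (p : E) ^ 1 * b)
    (hU₂ : ∀ u : Additive Eˣ, u ∈ U₂ ↔ ∃ b ∈ 𝒪[E], ((Additive.toMul u : Eˣ) : E) = 1 + (p : E) ^ 2 * b)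
    (hU₃ : ∀ u : Additive Eˣ, u ∈ U₃ ↔ ∃ b ∈ 𝒪[E], ((Additive.toMul u : Eˣ) : E) = 1 + (p : E) ^ 3 * b)
    (hOU : ∀ u : Additive Eˣ, u ∈ OU ↔
      ((Additive.toMul u : Eˣ) : E) ∈ 𝒪[E] ∧ (((Additive.toMul u)⁻¹ : Eˣ) : E) ∈ 𝒪[E])
    (O : Submodule ℤ E) (hO : ∀ x, x ∈ O ↔ x ∈ 𝒪[E])
    (OK : Submodule ℤ K) (hOK : ∀ a : K, a ∈ OK ↔ algebraMap K E a ∈ 𝒪[E]) :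
    Nat.card (IntertwiningMap σZ ((Representation.ofMulDistribMulAction (E ≃ₐ[K] E) Eˣ).quotient _
        (ModPRepCount.range_lsmul_le_comap (Representation.ofMulDistribMulAction (E ≃ₐ[K] E) Eˣ) p))) =
      Nat.card (OK ⧸ LinearMap.range (LinearMap.lsmul ℤ OK p)) ^ r *
      Nat.card (IntertwiningMap σZ ((Representation.ofMulDistribMulAction (E ≃ₐ[K] E) Eˣ).subrepresentation _
        (ModPRepCount.ker_lsmul_le_comap (Representation.ofMulDistribMulAction (E ≃ₐ[K] E) Eˣ) p))) *
      Nat.card σZ.invariants := by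
  have hU₁st := OneUnits.le_comap p hσ U₁ hU₁ (K := K)
  have hU₂st := OneUnits.le_comap p hσ U₂ hU₂ (K := K)
  have hOUst := units_le_comap hσ OU hOU (K := K)
  have hOst := LocalIntegers.integer_le_comap hσ O hO (K := K)
  rw [natCard_modP_field_units p hpv hσ hG σZ hZ U₁ U₂ OU hU₁ hU₂ hOU hU₁st hOUst O hO hOst,
    natCard_modP_units p hpv hG σZ hZ U₁ U₂ U₃ OU hU₁ hU₂ hU₃ hOU hU₁st hU₂st hOUst O hO hOst,
    LocalIntegers.natCard_intertwiningMap_modP_integer_eq_pow p hpv hσ hG σZ hZ hcard O hO hOst OK hOK]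
  obtain ⟨eT⟩ := nonempty_equiv_torsion_units p hp.out.ne_zero OU hOU hOUst (K := K)
  rw [ModPRepCount.natCard_intertwiningMap_congr_right σZ _ _ eT]

/-- **Milne, *ADT* I Lemma 2.11, counted** ("`[L^×^{(p)}] = [K:ℚ_p][𝔽_p[G]] + [μ_p(L)] + [𝔽_p]`
in `R_{𝔽_p}(G)`"): for `E/K` finite Galois with `Δ = Gal(E/K)` of order prime to `p` preserving
the valuation of the characteristic-`0` non-archimedean local field `E` (`|p| < 1`),
`𝒪_K = K ∩ 𝒪_E` (any membership-characterised `ℤ`-submodule `OK` of `K`), and every finite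
`Δ`-module `Z` with `pZ = 0`, `#Z = p^r`:

  `#Hom_Δ(Z, Eˣ/Eˣᵖ) = #(𝒪_K/p𝒪_K)^r · #Hom_Δ(Z, Eˣ[p]) · #Z^Δ`,

`Eˣ/Eˣᵖ` and `Eˣ[p] = μ_p(E)` being the canonical quotient / subrepresentation of the
representation of `Δ` on `Additive Eˣ`.  Log/exp-free proof: stages B1–B6b of this directory.
[cite: MilneADT2006, I §2 Lemma 2.11 (p. 33) and proof of Thm 2.8 (p. 34)] -/
theorem natCard_modP_field_units_eq [CharZero E] (hpv : ValuativeRel.valuation E p < 1)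
    (hσ : ∀ (σ : E ≃ₐ[K] E) (x : E), ValuativeRel.valuation E (σ x) = ValuativeRel.valuation E x)
    (hG : ¬ p ∣ Nat.card (E ≃ₐ[K] E))
    {Z : Type*} [AddCommGroup Z] [Finite Z] (σZ : Representation ℤ (E ≃ₐ[K] E) Z)
    (hZ : ∀ z : Z, p • z = 0) {r : ℕ} (hcard : Nat.card Z = p ^ r)
    (OK : Submodule ℤ K) (hOK : ∀ a : K, a ∈ OK ↔ algebraMap K E a ∈ 𝒪[E]) :
    Nat.card (IntertwiningMap σZ ((Representation.ofMulDistribMulAction (E ≃ₐ[K] E) Eˣ).quotient _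
        (ModPRepCount.range_lsmul_le_comap (Representation.ofMulDistribMulAction (E ≃ₐ[K] E) Eˣ) p))) =
      Nat.card (OK ⧸ LinearMap.range (LinearMap.lsmul ℤ OK p)) ^ r *
      Nat.card (IntertwiningMap σZ ((Representation.ofMulDistribMulAction (E ≃ₐ[K] E) Eˣ).subrepresentation _
        (ModPRepCount.ker_lsmul_le_comap (Representation.ofMulDistribMulAction (E ≃ₐ[K] E) Eˣ) p))) *
      Nat.card σZ.invariants := by
  obtain ⟨U₁, hU₁⟩ := exists_submodule p hpv (le_refl 1) (E := E)
  obtain ⟨U₂, hU₂⟩ := exists_submodule p hpv (by norm_num : 1 ≤ 2) (E := E)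
  obtain ⟨U₃, hU₃⟩ := exists_submodule p hpv (by norm_num : 1 ≤ 3) (E := E)
  obtain ⟨OU, hOU⟩ := exists_submodule_units (E := E)
  obtain ⟨O, hO⟩ := LocalIntegers.exists_submodule_integer (E := E)
  exact natCard_modP_field_units_eq' p hpv hσ hG σZ hZ hcard U₁ U₂ U₃ OU hU₁ hU₂ hU₃ hOU O hO OK hOK

end OneUnits

end Summit.BirchSwinnertonDyer.Rank1Residual.GaloisImage

end
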